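import Mathlib
import Summits.ValiantsHypothesis.ValiantsHypothesis.Theorems.BarrierLeverSuccinctHittingSetsForVPSpskUnconditional
import Summits.ValiantsHypothesis.ValiantsHypothesis.Theorems.BarrierLeverSuccinctHittingSetsForVPSps2Two
import HarnessLib

/-!
# `ΣΠΣ(k)` distinguishers are hit at exponents 2 (top fan-in `k ≤ n/4`) and 3 (`k ≤ n/3 · (n-1)`, in
particular every `k ≤ n`) — crux stmt-ValiantsHypothesis-14610 side; docket 8745/8749 of seat val-np-p5

**What is proved (unconditional; it does NOT close any item).** The tree's `isSuccinctHittingSet_spsk'`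
(Saxena–Seshadhri variable reduction + the `k`-seed separable generator): for `n ≥ 8`, `k ≤ n`,
`SmallCircuits ℂ n 10` hits every nonzero depth-3 distinguisher `D = Σ_{i<k} ∏_j ℓ_{ij}` with affine
`ℓ_{ij}` in the `N = C(2n,n)` coefficient variables. Exponent `10` is the cost of realising the `k`
seeds by `stub_separableCoeff` (exponent `8`). Here (as in `…Sps2Two` for `k = 2`) the seeds are
realised by POWERS OF AFFINE FORMS, `f = Σ_{j<k} y_j (1 + Σ_l s_{j,l} x_l)^n` (`≤ k(3n+3)` gates), whose
coefficient vector is the `k`-seed generator value WEIGHTED by the multinomials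
`α_μ = coeff_μ (1 + Σ_l x_l)^n ≠ 0`; the weights are absorbed into the distinguisher by the rescaling
`c_μ ↦ α_μ c_μ`, which maps `ΣΠΣ(k)` to `ΣΠΣ(k)` (`Sps2Two.coeff_aeval_scale`, `aeval_scale_ne_zero`).
Hence (`isSuccinctHittingSet_spsk_of_budget`): whenever `k(3n + 3) ≤ n^b`, `SmallCircuits ℂ n b` hits
every nonzero `ΣΠΣ(k)` distinguisher; in particular
* `isSuccinctHittingSet_spsk_two` : `4k ≤ n` (and `n ≥ 3`) ⇒ hit by `SmallCircuits ℂ n 2` — AT THE OPEN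
  RUNG: depth-3 distinguishers of top fan-in up to `n/4 = Θ(log N)`, any degree, any size;
* `isSuccinctHittingSet_spsk_three` : `k ≤ n`, `n ≥ 4` ⇒ hit by `SmallCircuits ℂ n 3` (tree: `10`);
* `not_isNaturalProof_spsk_two` / `_three`.

Honest framing: 14610-side bookkeeping (chart row 'ΣΠΣ(k), k ≤ n': 10 → 3; new b = 2 row for
`k ≤ n/4`); the door "E a ΣΠΣ(k) circuit of poly(N) top fan-in" of the b = 2 table stays OPEN
(Saxena–Seshadhri's reduction needs `d·M·k² + 1` field points but only `k` seeds — the obstruction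
to poly(N) fan-in is the seed count `k`, i.e. the size `k(3n+3)` of the realisation, not the
reduction); nothing here bears on `VP ≠ VNP`.

References: [SaxenaSeshadhri2012] Lemma 11 / Thm. 2; [ForbesShpilkaVolk2018] §4.1, Cor. 22,
Construction 29, Question 6.
-/

-- layout Summits/ValiantsHypothesis/ValiantsHypothesis forces the duplicated namespace component
set_option linter.dupNamespace false

noncomputable section

namespace Summit.ValiantsHypothesis.ValiantsHypothesis.Theorems.BarrierLever.SuccinctHittingSetsForVP

open Literature.Barriers.ValiantsHypothesis Literature.Computability.AlgebraicComplexity MvPolynomial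

namespace SpskTwo

variable {n : ℕ}

/-- **Realisation of the weighted `k`-seed generator.** For weights `y` and seeds `s`,
`f = Σ_{j<k} y_j (1 + Σ_l s_{j,l} x_l)^n` has degree `≤ n`, size `≤ k(3n+3)`, and
`coeff_μ f = α_μ · Σ_j y_j ∏_l s_{j,l}^{μ_l}` with `α_μ = coeff_μ (1 + Σ_l x_l)^n`.
[cite: ForbesShpilkaVolk2018, Construction 29] -/
theorem realisable {k b : ℕ} (hkb : k * (3 * n + 3) ≤ n ^ b) (y : Fin k → ℂ) (s : Fin k → Fin n → ℂ) :
    ∃ f ∈ SmallCircuits ℂ n b, ∀ μ : degLEMonomials n,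
      coeff (μ : Fin n →₀ ℕ) f =
        coeff (μ : Fin n →₀ ℕ) ((1 + ∑ i : Fin n, X i : MvPolynomial (Fin n) ℂ) ^ n) *
          ∑ j : Fin k, y j * ∏ l : Fin n, s j l ^ (μ : Fin n →₀ ℕ) l := by
  set Λ : Fin k → MvPolynomial (Fin n) ℂ :=
    fun j => (1 + ∑ i : Fin n, C (s j i) * X i) ^ n with hΛ
  refine ⟨∑ j : Fin k, C (y j) * Λ j, ⟨?_, ?_⟩, fun μ => ?_⟩
  · refine totalDegree_finsetSum_le fun j _ => (totalDegree_mul _ _).trans ?_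
    rw [totalDegree_C, zero_add]
    exact Sps2Two.totalDegree_scaledPow_le _
  · calc complexity (∑ j : Fin k, C (y j) * Λ j)
        ≤ ∑ j : Fin k, complexity (C (y j) * Λ j) + (Finset.univ : Finset (Fin k)).card :=
          complexity_finset_sum_le _ _
      _ ≤ ∑ _j : Fin k, (3 * n + 2) + (Finset.univ : Finset (Fin k)).card := by
          gcongr with j
          have h := complexity_mul_le_holds (C (y j) : MvPolynomial (Fin n) ℂ) (Λ j)
          rw [complexity_C_holds] at h
          have h2 : complexity (Λ j) ≤ 3 * n + 1 := Sps2Two.complexity_scaledPow_le _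
          omega
      _ = k * (3 * n + 3) := by simp; ring
      _ ≤ n ^ b := hkb
  · rw [coeff_sum, Finset.mul_sum]
    refine Finset.sum_congr rfl fun j _ => ?_
    rw [coeff_C_mul]
    have hc : coeff (μ : Fin n →₀ ℕ) (Λ j) =
        (∏ i : Fin n, s j i ^ (μ : Fin n →₀ ℕ) i) *
          coeff (μ : Fin n →₀ ℕ) ((1 + ∑ i : Fin n, X i : MvPolynomial (Fin n) ℂ) ^ n) :=
      Sps2Two.coeff_scaledPow (s j) μ
    rw [hc]
    ring

end SpskTwo

open Spsk SpskTwo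

/-- **`ΣΠΣ(k)` distinguishers are hit by `SmallCircuits ℂ n b` whenever `k(3n+3) ≤ n^b`.** For every
nonzero `D = Σ_{i<k} ∏_j ℓ_{ij}` (affine `ℓ_{ij}` in the coefficient variables) some
`f = Σ_{j<k} y_j (1 + Σ_l s_{j,l} x_l)^n` has `D(coeff f) ≠ 0`: Saxena–Seshadhri's reduction
(`SaxenaSeshadhri2012_lemma11_holds`) applied to the RESCALED distinguisher `D(α ∘ c)`, then the
Kronecker pull-back of the tree's `stub_spskHit`, then the affine-power realisation.
[cite: SaxenaSeshadhri2012, Lemma 11] [cite: ForbesShpilkaVolk2018, Cor. 22] -/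
theorem isSuccinctHittingSet_spsk_of_budget {n k b : ℕ} (hkb : k * (3 * n + 3) ≤ n ^ b) :
    IsSuccinctHittingSet (degLEMonomials n) (SmallCircuits ℂ n b)
      {D | ∃ (dd : Fin k → ℕ) (ℓ : (i : Fin k) → Fin (dd i) → MvPolynomial (degLEMonomials n) ℂ),
        (∀ i j, (ℓ i j).totalDegree ≤ 1) ∧ D = ∑ i, ∏ j, ℓ i j} := by
  -- adapted from the tree's `stub_spskHit` (exponent 10), with rescaled distinguisher and
  -- affine-power seeds
  classical
  rintro D ⟨dd, ℓ, hℓ, rfl⟩ hD0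
  -- the multinomial weights and the rescaled distinguisher `D' = D(α ∘ c)`
  set α : degLEMonomials n → ℂ := fun μ =>
    coeff (μ : Fin n →₀ ℕ) ((1 + ∑ i : Fin n, X i : MvPolynomial (Fin n) ℂ) ^ n) with hα
  have hα0 : ∀ μ, α μ ≠ 0 := fun μ => Sps2Two.weight_ne_zero μ
  set ℓ' : (i : Fin k) → Fin (dd i) → MvPolynomial (degLEMonomials n) ℂ :=
    fun i j => aeval (fun μ => C (α μ) * X μ) (ℓ i j) with hℓ'def
  have hℓ'deg : ∀ i j, (ℓ' i j).totalDegree ≤ 1 := fun i j => by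
    rw [hℓ'def, Sps2Two.totalDegree_aeval_scale hα0]; exact hℓ i j
  have hD'eq : (∑ i, ∏ j, ℓ' i j) = aeval (fun μ => C (α μ) * X μ) (∑ i, ∏ j, ℓ i j) := by
    simp only [hℓ'def, map_sum, map_prod]
  have hD'0 : (∑ i, ∏ j, ℓ' i j) ≠ 0 := by
    rw [hD'eq]; exact Sps2Two.aeval_scale_ne_zero hα0 hD0
  -- Kronecker renaming into `Fin M`
  set M := (n + 1) ^ n with hM
  let κ : degLEMonomials n → Fin M := fun μ =>
    ⟨∑ l : Fin n, (μ : Fin n →₀ ℕ) l * (n + 1) ^ (l : ℕ),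
      kronecker_lt _ fun l => (Finsupp.le_degree l _).trans μ.2⟩
  have hκ : Function.Injective κ := kronecker_injective
  have hD'' : (∑ i, ∏ j, rename κ (ℓ' i j)) ≠ 0 := by
    have : rename κ (∑ i, ∏ j, ℓ' i j) ≠ 0 := fun h0 =>
      hD'0 (rename_injective κ hκ (by rw [h0, map_zero]))
    simpa only [map_sum, map_prod] using this
  have hℓ'' : ∀ i j, (rename κ (ℓ' i j)).totalDegree ≤ 1 := fun i j =>
    (totalDegree_rename_le _ _).trans (hℓ'deg i j)
  -- the finite set of scalars `U = {2, 3, …}` of size `d M k² + 1`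
  set d := Finset.univ.sup dd with hd
  have hdd : ∀ i, dd i ≤ d := fun i => Finset.le_sup (Finset.mem_univ i)
  let U : Finset ℂ := (Finset.range (d * M * k ^ 2 + 1)).image fun t : ℕ => ((t + 2 : ℕ) : ℂ)
  have hU : d * M * k ^ 2 + 1 ≤ U.card := by
    rw [Finset.card_image_of_injective _ (fun a b hab => by
      exact_mod_cast (Nat.cast_injective hab : a + 2 = b + 2) |> Nat.add_right_cancel),
      Finset.card_range]
  obtain ⟨β, -, hβ⟩ := SaxenaSeshadhri2012_lemma11_holds ℂ k d M dd hdd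
    (fun i j => rename κ (ℓ' i j)) hℓ'' hD'' U hU
  -- a non-root `y` of the reduced polynomial
  obtain ⟨y, hy⟩ : ∃ y : Fin k → ℂ, eval y (MvPolynomial.aeval
      (fun i : Fin M => ∑ j : Fin k,
        C (β ^ ((i.1 + 1) * (j.1 + 1))) * (X j : MvPolynomial (Fin k) ℂ))
      (∑ i, ∏ j, rename κ (ℓ' i j))) ≠ 0 := by
    by_contra hcon
    push Not at hcon
    exact hβ (MvPolynomial.funext fun v => by simpa using hcon v)
  rw [LowDegreeEquations.eval_comp_aeval] at hy
  have hsum : (∑ i, ∏ j, rename κ (ℓ' i j)) = rename κ (∑ i, ∏ j, ℓ' i j) := by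
    simp only [map_sum, map_prod]
  rw [hsum, eval_rename, hD'eq, LowDegreeEquations.eval_comp_aeval] at hy
  -- realise the (weighted) point
  obtain ⟨f, hf, hcoeff⟩ := realisable hkb (fun j : Fin k => β ^ ((j : ℕ) + 1) * y j)
    (fun j l => β ^ (((j : ℕ) + 1) * (n + 1) ^ (l : ℕ)))
  refine ⟨f, hf, ?_⟩
  have hκv : ∀ μ : degLEMonomials n,
      ((κ μ : Fin M) : ℕ) = ∑ l : Fin n, (μ : Fin n →₀ ℕ) l * (n + 1) ^ (l : ℕ) := fun μ => rfl
  have hv : coeffVector (degLEMonomials n) f =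
      (fun μ => eval (((fun i : Fin M => eval y (∑ j : Fin k,
        C (β ^ ((i.1 + 1) * (j.1 + 1))) * (X j : MvPolynomial (Fin k) ℂ))) ∘ κ))
          (C (α μ) * X μ)) := by
    funext μ
    rw [coeffVector_apply, hcoeff μ]
    simp only [map_mul, eval_C, eval_X, Function.comp_apply, map_sum]
    congr 1
    refine Finset.sum_congr rfl fun j _ => ?_
    rw [hκv μ, pow_kronecker (n := n) β j (μ : Fin n →₀ ℕ)]
    ring
  rw [hv]
  exact hy

/-- **AT THE OPEN RUNG: `ΣΠΣ(k)` with top fan-in `k ≤ n/4` is hit by `SmallCircuits ℂ n 2`** (`n ≥ 3`):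
every nonzero `Σ_{i<k} ∏_j ℓ_{ij}` (affine `ℓ_{ij}`, any degree, any size) in the coefficient variables
is nonzero at the coefficient vector of some degree-`≤ n` polynomial of circuit size `≤ n²`.
[cite: ForbesShpilkaVolk2018, Cor. 22 and Question 6] -/
theorem isSuccinctHittingSet_spsk_two {n k : ℕ} (hn : 3 ≤ n) (hk : 4 * k ≤ n) :
    IsSuccinctHittingSet (degLEMonomials n) (SmallCircuits ℂ n 2)
      {D | ∃ (dd : Fin k → ℕ) (ℓ : (i : Fin k) → Fin (dd i) → MvPolynomial (degLEMonomials n) ℂ),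
        (∀ i j, (ℓ i j).totalDegree ≤ 1) ∧ D = ∑ i, ∏ j, ℓ i j} :=
  isSuccinctHittingSet_spsk_of_budget (by nlinarith)

/-- **`ΣΠΣ(k)`, `k ≤ n`, is hit by `SmallCircuits ℂ n 3`** (`n ≥ 4`; tree: exponent `10`).
[cite: ForbesShpilkaVolk2018, Cor. 22] -/
theorem isSuccinctHittingSet_spsk_three {n k : ℕ} (hn : 4 ≤ n) (hk : k ≤ n) :
    IsSuccinctHittingSet (degLEMonomials n) (SmallCircuits ℂ n 3)
      {D | ∃ (dd : Fin k → ℕ) (ℓ : (i : Fin k) → Fin (dd i) → MvPolynomial (degLEMonomials n) ℂ),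
        (∀ i j, (ℓ i j).totalDegree ≤ 1) ∧ D = ∑ i, ∏ j, ℓ i j} := by
  refine isSuccinctHittingSet_spsk_of_budget ?_
  have h1 : 3 * n + 3 ≤ n * n := by nlinarith
  calc k * (3 * n + 3) ≤ n * (3 * n + 3) := Nat.mul_le_mul_right _ hk
    _ ≤ n * (n * n) := Nat.mul_le_mul_left _ h1
    _ = n ^ 3 := by ring

/-- **No `ΣΠΣ(k)` natural proof against `SmallCircuits ℂ n b`, `b ≥ 2`, when `4k ≤ n`** (`n ≥ 3`; any
class `𝒟`). [cite: ForbesShpilkaVolk2018, Def. 1 and Cor. 22] -/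
theorem not_isNaturalProof_spsk_two {n k b : ℕ} (hn : 3 ≤ n) (hk : 4 * k ≤ n) (hb : 2 ≤ b)
    (𝒟 : Set (MvPolynomial (degLEMonomials n) ℂ))
    (dd : Fin k → ℕ) (ℓ : (i : Fin k) → Fin (dd i) → MvPolynomial (degLEMonomials n) ℂ)
    (hℓ : ∀ i j, (ℓ i j).totalDegree ≤ 1) :
    ¬ IsNaturalProof (degLEMonomials n) (SmallCircuits ℂ n b) 𝒟 (∑ i, ∏ j, ℓ i j) := by
  rintro ⟨-, hD0, hvan⟩
  obtain ⟨f, hf, hne⟩ := isSuccinctHittingSet_spsk_two hn hk (∑ i, ∏ j, ℓ i j) ⟨dd, ℓ, hℓ, rfl⟩ hD0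
  exact hne (hvan f (smallCircuits_mono ℂ hb (by omega) hf))

/-- **No `ΣΠΣ(k)` natural proof against `SmallCircuits ℂ n b`, `b ≥ 3`, for any `k ≤ n`** (`n ≥ 4`;
tree: `b ≥ 10`). [cite: ForbesShpilkaVolk2018, Def. 1 and Cor. 22] -/
theorem not_isNaturalProof_spsk_three {n k b : ℕ} (hn : 4 ≤ n) (hk : k ≤ n) (hb : 3 ≤ b)
    (𝒟 : Set (MvPolynomial (degLEMonomials n) ℂ))
    (dd : Fin k → ℕ) (ℓ : (i : Fin k) → Fin (dd i) → MvPolynomial (degLEMonomials n) ℂ)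
    (hℓ : ∀ i j, (ℓ i j).totalDegree ≤ 1) :
    ¬ IsNaturalProof (degLEMonomials n) (SmallCircuits ℂ n b) 𝒟 (∑ i, ∏ j, ℓ i j) := by
  rintro ⟨-, hD0, hvan⟩
  obtain ⟨f, hf, hne⟩ := isSuccinctHittingSet_spsk_three hn hk (∑ i, ∏ j, ℓ i j) ⟨dd, ℓ, hℓ, rfl⟩ hD0
  exact hne (hvan f (smallCircuits_mono ℂ hb (by omega) hf))

end Summit.ValiantsHypothesis.ValiantsHypothesis.Theorems.BarrierLever.SuccinctHittingSetsForVP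

end
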